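import Literature.AlgebraicGeometry.ModuliOfAbelianVarieties.SiegelFamilyRealCocyclesCoboundaries
import Literature.NumberTheory.ModularForms.SiegelUpperHalfSpaceEffectiveAction
import Literature.NumberTheory.ModularForms.SiegelThetaInversionFormula
import Mathlib.Topology.Baire.Lemmas
import Mathlib.Topology.Baire.LocallyCompactRegular
import HarnessLib

/-!
# Generic points of the real slices `h · iC_g ⊂ 𝔥_g` are fixed by no element of `Sp_{2g}(ℤ)` other
# than `±I`; hence every `τ`-cocycle of `Γ_g(2)` is a coboundary `τ(h)h⁻¹` with `h ∈ Sp_{2g}(ℤ)` INTEGRAL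
# (Goresky–Tai 2003, §4.4 proof of Cor. 11 — «Such points exist, and even form a dense subset of `𝔥_n^γ`» —
# with Prop. 10 and Prop. 6)

Topic `Literature/AlgebraicGeometry/ModuliOfAbelianVarieties` (the Siegel-family files, namespace
`Literature.AlgebraicGeometry.ModuliOfAbelianVarieties.SiegelModuli`).  Lane `lit-hodgefound` (Track 2
foundations library), prover seat p15 generation 52, row g52-#3, on top of g52-#1/#2
(`H¹(ℂ/ℝ, Sp_{2g}(ℝ))` trivial: a cocycle `γ` has `𝔥_g^γ = h · iC_g`), g51-#5
`SiegelFamilyRealPointsLevelTwoCoboundary` (Prop. 10: at a point of `𝔥_g^γ` fixed only by `±I`, a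
`Γ_g(2)`-cocycle is an INTEGRAL coboundary), g51-#6 (free action of `Γ_g(q)`, `q ≥ 3`), the tree's
`SiegelUpperHalfSpaceEffectiveAction` (`Z(γZ + δ) = αZ + β`; scalar blocks from commutation with the
symmetric matrices) and `GroupTheory/ArithmeticGroups/PositiveDefiniteConeProperAction` (the cone `C_g` of
positive definite symmetric matrices as a locally compact space `PosDefCone`) and `SiegelThetaInversionFormula`
(`I_smul_map_ofReal_mem`: `iY ∈ 𝔥_g`).  THEOREMS ONLY: no definition,
no instance, no notation, no named fact (net Literature debt `0`), no `sorry`.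

## Source, VERBATIM

M. Goresky, Y. S. Tai, *The moduli space of real abelian varieties with level structure*, Compositio
Math. **139** (2003) = arXiv:math/0108103, held `paper:arxiv-math_0108103`.  §4 p0008: «**Proposition 10.**
Let `γ ∈ Γ(2)` and suppose that `Z ∈ 𝔥_n` is not fixed by any element of `Sp(2n, ℤ)` other than `±I`.
Suppose that `Z̃ = γZ`.  Then there exists `h ∈ Sp(2n, ℤ)` such that `γ = h̃h⁻¹`, hence `𝔥_n^γ = h · iC_n`.
**Corollary 11.** Suppose `γ ∈ Γ(4m)` and `𝔥_n^γ ≠ ∅`.  Then there exists `g ∈ Γ_{2m}(2)` such that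
`γ = g̃g⁻¹` (hence `𝔥_n^γ = giC_n`).  4.4 Proof.  Let `Z ∈ 𝔥_n^γ` be a point which is not fixed by any
`g ∈ Sp(2n, ℤ)` other than `±I`.  Such points exist, and even form a dense subset of `𝔥_n^γ` because by
Proposition 6, the set `𝔥_n^γ` is a translate (by some element of `Sp(2n, ℝ)`) of the cone `iC_n`.  By
Proposition 10, there exists `h ∈ Sp(2n, ℤ)` so that `γ = h̃h⁻¹`.  By Lemma 9 this implies that `h = βu` for
some `β ∈ Γ_{2m}(2)` and some `u ∈ GL(n, ℤ)`.  Hence `γ = h̃h⁻¹ = β̃β⁻¹` as claimed.»  §2.2 p0004: «Its fixed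
point set is the orbit `iC_n = GL(n, ℝ).iI` … `C_n ≅ GL(n, ℝ)/O(n)` denotes the cone of positive definite
symmetric real matrices.»  G. van der Geer, *Siegel modular forms and their applications* (2008), §2:
«The group `Sp(2g, ℝ)/{±1}` acts effectively on `𝓗_g`» (the tree's `forall_smul_eq_self_iff`).

## The density statement made precise, and its proof

For `h ∈ Sp_{2g}(ℝ)` the real slice `h · iC_g = {Ω ∈ 𝔥_g : Re(h⁻¹ • Ω) = 0}` is parametrised by the
cone `C_g` of positive definite symmetric `Y` via `Y ↦ h • iY`.  For a COUNTABLE set `S ⊂ Sp_{2g}(ℝ)` (e.g.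
`Γ_g`), the `Y ∈ C_g` such that every `P ∈ S` fixing `h • iY` is `±I` form a DENSE (residual) subset of
`C_g` (`dense_setOf_forall_smul_eq_imp`): by Baire's theorem in the locally compact cone it suffices that
for `P ≠ ±I` the closed set `{Y : P • h • iY = h • iY}` has empty interior; if it contained a
neighbourhood of `Y₀` then `Q = h⁻¹Ph` would fix `i(Y₀ + tH)` for every symmetric `H` and all small `t`,
i.e. (`Z(γZ + δ) = αZ + β` at `Z = iY`) `B + YCY = 0` and `AY = YD` for `Q = (A B; C D)` and all these
`Y`; the scaling `H = Y₀` gives `C = 0 = B`, then `AH = HD` for every symmetric `H` forces `A = D = c·1`,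
and `ᵗAD − ᵗCB = 1` gives `c = ±1` (`coe_eq_one_or_eq_neg_one_of_forall_eventually`).  With the genericity
in hand: a `τ`-cocycle `γ ∈ Γ_g(2)` (`τ(γ)γ = 1`) has `𝔥_g^γ = h · iC_g` for some `h ∈ Sp_{2g}(ℝ)` (g52-#1,
Prop. 1), hence a real point fixed by no element of `Γ_g` other than `±I`, hence (g51-#5, Prop. 10) is a
coboundary `τ(h')h'⁻¹` with `h' ∈ Γ_g = Sp_{2g}(ℤ)` INTEGRAL; for `γ ∈ Γ_g(q)`, `q ≥ 3` even (in particular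
`Γ(4m)`), the cocycle condition follows from `𝔥_g^γ ≠ ∅` (g51-#6), which is Cor. 11 up to its last sentence
(the refinement `h' = βu`, `β ∈ Γ_{2m}(2)`, by Lemma 9 (3), is not in this row).

## What is proved

* §1 `toBlocks_add_mul_mul_eq_zero_of_smul_eq`
  (`Q • iY = iY ⟹ B + YCY = 0 ∧ AY = YD`), **`coe_eq_one_or_eq_neg_one_of_forall_eventually`** (these
  identities near `Y₀` along all symmetric directions force `Q = ±I`).
* §2 `continuous_smul_I_smul` (`Y ↦ h • iY` is continuous on the cone), `eventually_posDef_add_smul`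
  (`Y₀ + tH > 0` for small `t`), **`coe_eq_one_or_eq_neg_one_of_mem_interior`** (a `P` fixing a
  neighbourhood in `h · iC_g` is `±I`), **`dense_setOf_forall_smul_eq_imp`** (for countable `S`: the
  `S`-generic `Y` are dense in `C_g`), `countable_siegelModularGroup`,
  **`exists_real_point_forall_smul_eq_imp`** («such points exist»: a point of `h · iC_g` fixed by no
  `P ∈ Γ_g` other than `±I`).
* §3 **`exists_mem_siegelModularGroup_eq_iStarConj_mul_inv_of_mem_siegelPrincipalGamma_two`** (every
  `τ`-cocycle `γ ∈ Γ_g(2)` is `τ(h')h'⁻¹` with `h' ∈ Γ_g`, and `𝔥_g^γ = h' · iC_g`),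
  **`exists_mem_siegelModularGroup_eq_iStarConj_mul_inv_of_exists_smul_eq_negConj`** (the same for
  `γ ∈ Γ_g(q)`, `q ≥ 3` even, from `𝔥_g^γ ≠ ∅` — Cor. 11 without the `Γ_{2m}(2)`-refinement).

## References

* [GoreskyTai2003RealModuli] M. Goresky, Y. S. Tai, Compositio Math. 139 (2003) 1–27, §2.2, §3 Prop. 1,
  Prop. 6, §4 Prop. 10, Cor. 11 and its proof §4.4.
* [vanderGeer2008] G. van der Geer, Siegel modular forms and their applications, in: The 1-2-3 of modular
  forms, Springer 2008, §2 («acts effectively»).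
* [Lange2023AbelianVarietiesComplex] H. Lange (2023), §3.1.1 (`𝔥_g` open in the symmetric matrices), §3.1.3
  Prop. 3.1.7.
-/

noncomputable section

open scoped Matrix ComplexConjugate Topology
open Matrix Function Module Filter

namespace Literature.AlgebraicGeometry.ModuliOfAbelianVarieties

namespace SiegelModuli

open Literature.NumberTheory.Automorphic (siegelUpperHalfSpace mem_siegelUpperHalfSpace_iff)
open Literature.NumberTheory.ModularForms (I_smul_map_ofReal_mem)
open Literature.NumberTheory.ModularForms.SiegelUpperHalfSpace (symplecticIntHom siegelModularGroup
  pointI coe_pointI num denom num_def denom_def coe_smul mul_denom_eq_num_of_smul_eq)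
open Literature.NumberTheory.ModularForms.SiegelModularForm (siegelPrincipalGamma siegelPrincipalGamma_anti)
open Literature.GroupTheory.ArithmeticGroups (PosDefCone isOpen_setOf_dotProduct_mulVec_pos)

variable {g : ℕ}

/-! ## §0 Casting helpers (private) -/

/-- `X_ℂ + iW_ℂ = X'_ℂ + iW'_ℂ ⟹ X = X' ∧ W = W'` (real and imaginary parts). [folklore] -/
private theorem re_im_inj_g52c {m n : Type*} {X W X' W' : Matrix m n ℝ}
    (h : X.map ((↑) : ℝ → ℂ) + Complex.I • W.map ((↑) : ℝ → ℂ) =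
      X'.map ((↑) : ℝ → ℂ) + Complex.I • W'.map ((↑) : ℝ → ℂ)) : X = X' ∧ W = W' := by
  constructor
  · ext i j
    have hij := congrArg Complex.re (congr_fun (congr_fun h i) j)
    simpa using hij
  · ext i j
    have hij := congrArg Complex.im (congr_fun (congr_fun h i) j)
    simpa using hij

/-- The blocks of `M_ℂ` are the complexified blocks of `M`. [folklore] -/
private theorem toBlocks_map_ofReal_g52c (M : Matrix (Fin g ⊕ Fin g) (Fin g ⊕ Fin g) ℝ) :
    (M.map ((↑) : ℝ → ℂ)).toBlocks₁₁ = M.toBlocks₁₁.map ((↑) : ℝ → ℂ) ∧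
      (M.map ((↑) : ℝ → ℂ)).toBlocks₁₂ = M.toBlocks₁₂.map ((↑) : ℝ → ℂ) ∧
      (M.map ((↑) : ℝ → ℂ)).toBlocks₂₁ = M.toBlocks₂₁.map ((↑) : ℝ → ℂ) ∧
      (M.map ((↑) : ℝ → ℂ)).toBlocks₂₂ = M.toBlocks₂₂.map ((↑) : ℝ → ℂ) :=
  ⟨rfl, rfl, rfl, rfl⟩

/-! ## §1 `Q • iY = iY` near `Y₀` along every symmetric direction forces `Q = ±I` -/

/-- `Re(iY) = 0`. [cite: GoreskyTai2003RealModuli, §2.2 («Its fixed point set is the orbit `iC_n`»)] -/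
theorem map_re_I_smul_map_ofReal (Y : Matrix (Fin g) (Fin g) ℝ) :
    (Complex.I • Y.map ((↑) : ℝ → ℂ)).map Complex.re = 0 := by
  ext i j; simp

/-- `Im(iY) = Y`. [cite: GoreskyTai2003RealModuli, §2.2] -/
theorem map_im_I_smul_map_ofReal (Y : Matrix (Fin g) (Fin g) ℝ) :
    (Complex.I • Y.map ((↑) : ℝ → ℂ)).map Complex.im = Y := by
  ext i j; simp

/-- A point with `Re Ω = 0` is `iY` with `Y = Im Ω`. [cite: GoreskyTai2003RealModuli, §2.2 («`τ(Z) = −Z̄`.  Its fixed point set is … `iC_n`»)] -/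
theorem eq_I_smul_map_im_of_map_re_eq_zero {Ω : Matrix (Fin g) (Fin g) ℂ} (h : Ω.map Complex.re = 0) :
    Ω = Complex.I • (Ω.map Complex.im).map ((↑) : ℝ → ℂ) := by
  ext i j
  have hij : (Ω i j).re = 0 := by
    have := congr_fun (congr_fun h i) j
    simpa using this
  apply Complex.ext
  · simp [hij]
  · simp

/-- **`Q • iY = iY ⟹ B + YCY = 0` and `AY = YD`** for `Q = (A B; C D) ∈ Sp_{2g}(ℝ)` and `Y ∈ C_g`:
from `Z(CZ + D) = AZ + B` at `Z = iY`, `−YCY + iYD = B + iAY`, compare real and imaginary parts.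
[cite: vanderGeer2008, §2 (p. 184, the action and its kernel)] [cite: GoreskyTai2003RealModuli, §2.1–§2.2] -/
theorem toBlocks_add_mul_mul_eq_zero_of_smul_eq {Q : Matrix.symplecticGroup (Fin g) ℝ}
    {Y : Matrix (Fin g) (Fin g) ℝ} (hY : Y.PosDef)
    (h : Q • (⟨Complex.I • Y.map ((↑) : ℝ → ℂ), I_smul_map_ofReal_mem hY⟩ :
        siegelUpperHalfSpace g) =
      ⟨Complex.I • Y.map ((↑) : ℝ → ℂ), I_smul_map_ofReal_mem hY⟩) :
    (Q : Matrix (Fin g ⊕ Fin g) (Fin g ⊕ Fin g) ℝ).toBlocks₁₂ +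
          Y * (Q : Matrix (Fin g ⊕ Fin g) (Fin g ⊕ Fin g) ℝ).toBlocks₂₁ * Y = 0 ∧
      (Q : Matrix (Fin g ⊕ Fin g) (Fin g ⊕ Fin g) ℝ).toBlocks₁₁ * Y =
        Y * (Q : Matrix (Fin g ⊕ Fin g) (Fin g ⊕ Fin g) ℝ).toBlocks₂₂ := by
  have hZ := mul_denom_eq_num_of_smul_eq h
  obtain ⟨h11, h12, h21, h22⟩ := toBlocks_map_ofReal_g52c (Q : Matrix (Fin g ⊕ Fin g) (Fin g ⊕ Fin g) ℝ)
  change (Complex.I • Y.map ((↑) : ℝ → ℂ)) *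
      denom ((Q : Matrix (Fin g ⊕ Fin g) (Fin g ⊕ Fin g) ℝ).map ((↑) : ℝ → ℂ)) (Complex.I • Y.map ((↑) : ℝ → ℂ)) =
    num ((Q : Matrix (Fin g ⊕ Fin g) (Fin g ⊕ Fin g) ℝ).map ((↑) : ℝ → ℂ)) (Complex.I • Y.map ((↑) : ℝ → ℂ)) at hZ
  rw [num_def, denom_def, h11, h12, h21, h22] at hZ
  have hφ : ∀ M : Matrix (Fin g) (Fin g) ℝ, M.map ((↑) : ℝ → ℂ) = Complex.ofRealHom.mapMatrix M := fun M ↦ rfl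
  simp only [hφ] at hZ
  have e : Complex.ofRealHom.mapMatrix (-(Y * (Q : Matrix (Fin g ⊕ Fin g) (Fin g ⊕ Fin g) ℝ).toBlocks₂₁ * Y)) +
        Complex.I • Complex.ofRealHom.mapMatrix (Y * (Q : Matrix (Fin g ⊕ Fin g) (Fin g ⊕ Fin g) ℝ).toBlocks₂₂) =
      Complex.ofRealHom.mapMatrix (Q : Matrix (Fin g ⊕ Fin g) (Fin g ⊕ Fin g) ℝ).toBlocks₁₂ +
        Complex.I • Complex.ofRealHom.mapMatrix ((Q : Matrix (Fin g ⊕ Fin g) (Fin g ⊕ Fin g) ℝ).toBlocks₁₁ * Y) := by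
    rw [map_neg, map_mul, map_mul, map_mul, map_mul]
    calc -(Complex.ofRealHom.mapMatrix Y * Complex.ofRealHom.mapMatrix (Q : Matrix (Fin g ⊕ Fin g) (Fin g ⊕ Fin g) ℝ).toBlocks₂₁ *
              Complex.ofRealHom.mapMatrix Y) +
            Complex.I • (Complex.ofRealHom.mapMatrix Y *
              Complex.ofRealHom.mapMatrix (Q : Matrix (Fin g ⊕ Fin g) (Fin g ⊕ Fin g) ℝ).toBlocks₂₂)
        = Complex.I • Complex.ofRealHom.mapMatrix Y *
            (Complex.ofRealHom.mapMatrix (Q : Matrix (Fin g ⊕ Fin g) (Fin g ⊕ Fin g) ℝ).toBlocks₂₁ *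
                Complex.I • Complex.ofRealHom.mapMatrix Y +
              Complex.ofRealHom.mapMatrix (Q : Matrix (Fin g ⊕ Fin g) (Fin g ⊕ Fin g) ℝ).toBlocks₂₂) := by
          simp only [Matrix.mul_add, Matrix.mul_smul, Matrix.smul_mul, smul_smul, Complex.I_mul_I, neg_one_smul,
            Matrix.mul_assoc]
      _ = _ := hZ
      _ = Complex.ofRealHom.mapMatrix (Q : Matrix (Fin g ⊕ Fin g) (Fin g ⊕ Fin g) ℝ).toBlocks₁₂ +
            Complex.I • (Complex.ofRealHom.mapMatrix (Q : Matrix (Fin g ⊕ Fin g) (Fin g ⊕ Fin g) ℝ).toBlocks₁₁ *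
              Complex.ofRealHom.mapMatrix Y) := by
          rw [Matrix.mul_smul, add_comm]
  obtain ⟨h1, h2⟩ := re_im_inj_g52c e
  exact ⟨by rw [← h1, neg_add_cancel], h2.symm⟩

/-- **If `Q • iY = iY` for all `Y` near `Y₀` along every symmetric direction, then `Q = ±I`.**  Precisely: if
for every symmetric `H` the identities `B + YCY = 0`, `AY = YD` hold at `Y = Y₀ + tH` for all small `t`,
then `Q = (A B; C D) = ±I` (scaling `H = Y₀`: `((1+t)² − 1)Y₀CY₀ = 0`, so `C = 0 = B`; then `AH = HD` for all
symmetric `H`, so `A = D = c·1` commutes with the `E_jk`, and `ᵗAD − ᵗCB = 1` gives `c² = 1`) — the local form of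
«`Sp(2g, ℝ)/{±1}` acts effectively». [cite: vanderGeer2008, §2 (p. 184)] [cite: GoreskyTai2003RealModuli, §4.4 («Such points exist, and even form a dense subset of `𝔥_n^γ`»)] -/
theorem coe_eq_one_or_eq_neg_one_of_forall_eventually {Q : Matrix.symplecticGroup (Fin g) ℝ}
    {Y₀ : Matrix (Fin g) (Fin g) ℝ} (hY₀ : Y₀.PosDef)
    (h : ∀ H : Matrix (Fin g) (Fin g) ℝ, H.IsSymm → ∀ᶠ t : ℝ in 𝓝 0,
      (Q : Matrix (Fin g ⊕ Fin g) (Fin g ⊕ Fin g) ℝ).toBlocks₁₂ +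
            (Y₀ + t • H) * (Q : Matrix (Fin g ⊕ Fin g) (Fin g ⊕ Fin g) ℝ).toBlocks₂₁ * (Y₀ + t • H) = 0 ∧
        (Q : Matrix (Fin g ⊕ Fin g) (Fin g ⊕ Fin g) ℝ).toBlocks₁₁ * (Y₀ + t • H) =
          (Y₀ + t • H) * (Q : Matrix (Fin g ⊕ Fin g) (Fin g ⊕ Fin g) ℝ).toBlocks₂₂) :
    (Q : Matrix (Fin g ⊕ Fin g) (Fin g ⊕ Fin g) ℝ) = 1 ∨ (Q : Matrix (Fin g ⊕ Fin g) (Fin g ⊕ Fin g) ℝ) = -1 := by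
  -- the degenerate case `g = 0`
  rcases isEmpty_or_nonempty (Fin g) with hg | ⟨⟨i0⟩⟩
  · left
    ext i j
    exact isEmptyElim i
  set A := (Q : Matrix (Fin g ⊕ Fin g) (Fin g ⊕ Fin g) ℝ).toBlocks₁₁ with hAdef
  set B := (Q : Matrix (Fin g ⊕ Fin g) (Fin g ⊕ Fin g) ℝ).toBlocks₁₂ with hBdef
  set C := (Q : Matrix (Fin g ⊕ Fin g) (Fin g ⊕ Fin g) ℝ).toBlocks₂₁ with hCdef
  set D := (Q : Matrix (Fin g ⊕ Fin g) (Fin g ⊕ Fin g) ℝ).toBlocks₂₂ with hDdef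
  have hY₀s : Y₀.IsSymm := by
    have := hY₀.isHermitian.eq
    rwa [Matrix.conjTranspose_eq_transpose_of_trivial] at this
  have hdet : IsUnit Y₀.det := (Matrix.isUnit_iff_isUnit_det _).1 hY₀.isUnit
  -- from `∀ᶠ t, P t`: `P 0` and some `0 < t < 1` with `P t`
  have aux : ∀ {P : ℝ → Prop}, (∀ᶠ t in 𝓝 0, P t) → P 0 ∧ ∃ t : ℝ, 0 < t ∧ t < 1 ∧ P t := by
    intro P hP
    refine ⟨hP.self_of_nhds, ?_⟩
    obtain ⟨ε, hε, hball⟩ := Metric.eventually_nhds_iff.1 hP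
    refine ⟨min (ε / 2) (1 / 2), by positivity, ?_, hball ?_⟩
    · calc min (ε / 2) (1 / 2) ≤ 1 / 2 := min_le_right _ _
        _ < 1 := by norm_num
    · rw [Real.dist_eq, sub_zero, abs_of_pos (by positivity)]
      calc min (ε / 2) (1 / 2) ≤ ε / 2 := min_le_left _ _
        _ < ε := by linarith
  -- (a) `t = 0` and the scaling direction `H = Y₀`
  obtain ⟨⟨hB0, hA0⟩, t, ht0, -, hBt, -⟩ := aux (h Y₀ hY₀s)
  simp only [zero_smul, add_zero] at hB0 hA0
  have hsc : Y₀ + t • Y₀ = (1 + t) • Y₀ := by rw [add_smul, one_smul]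
  rw [hsc, Matrix.smul_mul, Matrix.smul_mul, Matrix.mul_smul, smul_smul] at hBt
  have hYCY : Y₀ * C * Y₀ = 0 := by
    have e : ((1 + t) * (1 + t) - 1) • (Y₀ * C * Y₀) = 0 := by
      rw [sub_smul, one_smul, sub_eq_zero, eq_neg_of_add_eq_zero_right hBt, eq_neg_of_add_eq_zero_right hB0]
    have hne : (1 + t) * (1 + t) - 1 ≠ 0 := by nlinarith
    exact (smul_eq_zero.1 e).resolve_left hne
  have hC : C = 0 := by
    calc C = Y₀⁻¹ * (Y₀ * C * Y₀) * Y₀⁻¹ := by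
          rw [Matrix.mul_assoc Y₀ C Y₀, ← Matrix.mul_assoc Y₀⁻¹, Matrix.nonsing_inv_mul _ hdet, Matrix.one_mul,
            Matrix.mul_assoc, Matrix.mul_nonsing_inv _ hdet, Matrix.mul_one]
      _ = 0 := by rw [hYCY, Matrix.mul_zero, Matrix.zero_mul]
  have hB : B = 0 := by rwa [hYCY, add_zero] at hB0
  -- (c) `AH = HD` for every symmetric `H`
  have hAH : ∀ H : Matrix (Fin g) (Fin g) ℝ, H.IsSymm → A * H = H * D := by
    intro H hH
    obtain ⟨-, s, hs0, -, -, hAs⟩ := aux (h H hH)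
    rw [Matrix.mul_add, Matrix.add_mul, hA0, add_right_inj, Matrix.mul_smul, Matrix.smul_mul] at hAs
    exact smul_right_injective _ hs0.ne' hAs
  have hAD : A = D := by simpa using hAH 1 Matrix.isSymm_one
  have hcomm : ∀ H : Matrix (Fin g) (Fin g) ℝ, H.IsSymm → Commute H A := fun H hH ↦ by
    change H * A = A * H
    rw [hAH H hH, hAD]
  -- (d) `A` commutes with every `E_jk`, hence is a scalar
  obtain ⟨c, hc⟩ : ∃ c : ℝ, A = c • (1 : Matrix (Fin g) (Fin g) ℝ) := by
    have hpair : Pairwise fun j k ↦ Commute (Matrix.single j k (1 : ℝ)) A := by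
      intro j k hjk
      have h1 : Commute (Matrix.single j j (1 : ℝ)) A :=
        hcomm _ (by rw [Matrix.IsSymm, Matrix.transpose_single])
      have h2 : Commute (Matrix.single j k (1 : ℝ) + Matrix.single k j 1) A :=
        hcomm _ (by rw [Matrix.IsSymm, transpose_add, Matrix.transpose_single, Matrix.transpose_single, add_comm])
      have h3 : Matrix.single j j (1 : ℝ) * (Matrix.single j k 1 + Matrix.single k j 1) = Matrix.single j k 1 := by
        rw [Matrix.mul_add, Matrix.single_mul_single_same, mul_one, Matrix.single_mul_single_of_ne (h := hjk),
          add_zero]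
      rw [← h3]
      exact h1.mul_left h2
    obtain ⟨c, hc⟩ := Matrix.mem_range_scalar_of_commute_single hpair
    exact ⟨c, by rw [← hc, Matrix.scalar_apply, Matrix.smul_one_eq_diagonal]⟩
  -- (e) `Q = diag(c, c)` is symplectic, so `c² = 1`
  have hQ : (Q : Matrix (Fin g ⊕ Fin g) (Fin g ⊕ Fin g) ℝ) =
      Matrix.fromBlocks (c • (1 : Matrix (Fin g) (Fin g) ℝ)) 0 0 (c • (1 : Matrix (Fin g) (Fin g) ℝ)) := by
    rw [← Matrix.fromBlocks_toBlocks (Q : Matrix (Fin g ⊕ Fin g) (Fin g ⊕ Fin g) ℝ)]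
    change Matrix.fromBlocks A B C D = _
    rw [hB, hC, ← hAD, hc]
  have hmem : Matrix.fromBlocks (c • (1 : Matrix (Fin g) (Fin g) ℝ)) 0 0 (c • (1 : Matrix (Fin g) (Fin g) ℝ)) ∈
      Matrix.symplecticGroup (Fin g) ℝ := hQ ▸ Q.2
  have hc2 : c * c = 1 := by
    have e := (SymplecticGroup.fromBlocks_mem_iff.1 hmem).2.2
    rw [Matrix.transpose_smul, Matrix.transpose_one, Matrix.transpose_zero, Matrix.zero_mul, sub_zero,
      Matrix.smul_mul, Matrix.one_mul, smul_smul] at e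
    have := congr_fun (congr_fun e i0) i0
    simpa using this
  rcases mul_self_eq_one_iff.1 hc2 with rfl | rfl
  · left
    rw [hQ, one_smul, Matrix.fromBlocks_one]
  · right
    rw [hQ, neg_smul, one_smul, ← Matrix.fromBlocks_one, Matrix.fromBlocks_neg, neg_zero]

/-! ## §2 Genericity on the real slices `h · iC_g` (Baire in the cone `C_g`) -/

/-- `Y ↦ h • iY` is continuous on the cone `C_g` (joint continuity of the action, Prop. 3.1.6).
[cite: Lange2023AbelianVarietiesComplex, §3.1.3 Prop. 3.1.6, p. 160] -/
theorem continuous_smul_I_smul (x : Matrix.symplecticGroup (Fin g) ℝ) :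
    Continuous fun Y : PosDefCone (Fin g) ↦
      x • (⟨Complex.I • (Y : Matrix (Fin g) (Fin g) ℝ).map ((↑) : ℝ → ℂ),
        I_smul_map_ofReal_mem Y.posDef⟩ : siegelUpperHalfSpace g) := by
  have hc : Continuous fun Y : PosDefCone (Fin g) ↦ Complex.I • (Y : Matrix (Fin g) (Fin g) ℝ).map ((↑) : ℝ → ℂ) :=
    (PosDefCone.continuous_coe.matrix_map Complex.continuous_ofReal).const_smul Complex.I
  exact (hc.subtype_mk _).const_smul x

/-- `Y₀ + tH` stays positive definite for small `t` (`C_g` is open in the symmetric matrices).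
[cite: Lange2023AbelianVarietiesComplex, §3.1.1 («`𝔥_g` … open submanifold of the vector space of symmetric matrices»), p. 158] -/
theorem eventually_posDef_add_smul {Y₀ : Matrix (Fin g) (Fin g) ℝ} (hY₀ : Y₀.PosDef)
    {H : Matrix (Fin g) (Fin g) ℝ} (hH : H.IsSymm) : ∀ᶠ t : ℝ in 𝓝 0, (Y₀ + t • H).PosDef := by
  have hcont : Continuous fun t : ℝ ↦ Y₀ + t • H := continuous_const.add (continuous_id.smul continuous_const)
  have h0 : Y₀ + (0 : ℝ) • H ∈ {S : Matrix (Fin g) (Fin g) ℝ | ∀ v : Fin g → ℝ, v ≠ 0 → 0 < v ⬝ᵥ S *ᵥ v} := by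
    rw [zero_smul, add_zero]
    intro v hv
    simpa using hY₀.dotProduct_mulVec_pos hv
  have hev := hcont.continuousAt.eventually_mem (isOpen_setOf_dotProduct_mulVec_pos.mem_nhds h0)
  filter_upwards [hev] with t ht
  have hY₀T : Y₀ᵀ = Y₀ := by
    have := hY₀.isHermitian.eq
    rwa [Matrix.conjTranspose_eq_transpose_of_trivial] at this
  refine Matrix.PosDef.of_dotProduct_mulVec_pos ?_ fun v hv ↦ ?_
  · rw [Matrix.IsHermitian, Matrix.conjTranspose_eq_transpose_of_trivial, Matrix.transpose_add,
      Matrix.transpose_smul, hY₀T, hH.eq]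
  · simpa using ht v hv

/-- **A `P ∈ Sp_{2g}(ℝ)` fixing a whole neighbourhood in the real slice `x · iC_g` is `±I`**: if `Y₀` is an
interior point (in the cone `C_g`) of `{Y : P • x • iY = x • iY}` then `P = ±I` (apply §1 to `Q = x⁻¹Px`
along the curves `Y₀ + tH`).
[cite: GoreskyTai2003RealModuli, §4.4 («form a dense subset of `𝔥_n^γ` … a translate … of the cone `iC_n`»)] [cite: vanderGeer2008, §2 (p. 184)] -/
theorem coe_eq_one_or_eq_neg_one_of_mem_interior (x P : Matrix.symplecticGroup (Fin g) ℝ)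
    {Y₀ : PosDefCone (Fin g)}
    (hY₀ : Y₀ ∈ interior {Y : PosDefCone (Fin g) |
      P • x • (⟨Complex.I • (Y : Matrix (Fin g) (Fin g) ℝ).map ((↑) : ℝ → ℂ),
          I_smul_map_ofReal_mem Y.posDef⟩ : siegelUpperHalfSpace g) =
        x • ⟨Complex.I • (Y : Matrix (Fin g) (Fin g) ℝ).map ((↑) : ℝ → ℂ),
          I_smul_map_ofReal_mem Y.posDef⟩}) :
    (P : Matrix (Fin g ⊕ Fin g) (Fin g ⊕ Fin g) ℝ) = 1 ∨ (P : Matrix (Fin g ⊕ Fin g) (Fin g ⊕ Fin g) ℝ) = -1 := by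
  obtain ⟨V, hVsub, hVopen, hY₀V⟩ := mem_interior.1 hY₀
  obtain ⟨V', hV'open, hV'⟩ := isOpen_induced_iff.1 hVopen
  set Q : Matrix.symplecticGroup (Fin g) ℝ := x⁻¹ * P * x with hQdef
  have hQ := coe_eq_one_or_eq_neg_one_of_forall_eventually (Q := Q) Y₀.posDef (fun H hH ↦ by
    have hcont : Continuous fun t : ℝ ↦ (Y₀ : Matrix (Fin g) (Fin g) ℝ) + t • H :=
      continuous_const.add (continuous_id.smul continuous_const)
    have h0 : (Y₀ : Matrix (Fin g) (Fin g) ℝ) + (0 : ℝ) • H ∈ V' := by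
      rw [zero_smul, add_zero]
      exact (Set.ext_iff.1 hV' Y₀).2 hY₀V
    have hev := hcont.continuousAt.eventually_mem (hV'open.mem_nhds h0)
    filter_upwards [hev, eventually_posDef_add_smul Y₀.posDef hH] with t htV htpos
    -- the point `Y₀ + tH` of the cone lies in `V ⊆ {fixed}`
    have hmem : (⟨(Y₀ : Matrix (Fin g) (Fin g) ℝ) + t • H, htpos⟩ : PosDefCone (Fin g)) ∈ V :=
      (Set.ext_iff.1 hV' ⟨(Y₀ : Matrix (Fin g) (Fin g) ℝ) + t • H, htpos⟩).1 htV
    have hfix := hVsub hmem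
    simp only [Set.mem_setOf_eq] at hfix
    -- `Q • i(Y₀ + tH) = i(Y₀ + tH)`
    have hQfix : Q • (⟨Complex.I • ((Y₀ : Matrix (Fin g) (Fin g) ℝ) + t • H).map ((↑) : ℝ → ℂ),
          I_smul_map_ofReal_mem htpos⟩ : siegelUpperHalfSpace g) =
        ⟨Complex.I • ((Y₀ : Matrix (Fin g) (Fin g) ℝ) + t • H).map ((↑) : ℝ → ℂ),
          I_smul_map_ofReal_mem htpos⟩ := by
      rw [hQdef, mul_smul, mul_smul, inv_smul_eq_iff]
      exact hfix
    exact toBlocks_add_mul_mul_eq_zero_of_smul_eq htpos hQfix)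
  -- back to `P = x Q x⁻¹`
  have hP : P = x * Q * x⁻¹ := by rw [hQdef]; group
  rcases hQ with hQ1 | hQ1
  · left
    have : Q = 1 := Subtype.ext hQ1
    rw [hP, this, mul_one, mul_inv_cancel]
    rfl
  · right
    have hPmat : (P : Matrix (Fin g ⊕ Fin g) (Fin g ⊕ Fin g) ℝ) =
        (x : Matrix (Fin g ⊕ Fin g) (Fin g ⊕ Fin g) ℝ) * Q * ((x⁻¹ : Matrix.symplecticGroup (Fin g) ℝ) :
          Matrix (Fin g ⊕ Fin g) (Fin g ⊕ Fin g) ℝ) := by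
      rw [hP]; rfl
    rw [hPmat, hQ1, Matrix.mul_neg, Matrix.mul_one, Matrix.neg_mul]
    have : (x : Matrix (Fin g ⊕ Fin g) (Fin g ⊕ Fin g) ℝ) *
        ((x⁻¹ : Matrix.symplecticGroup (Fin g) ℝ) : Matrix (Fin g ⊕ Fin g) (Fin g ⊕ Fin g) ℝ) = 1 := by
      rw [← Submonoid.coe_mul, mul_inv_cancel]; rfl
    rw [this]

/-- **GENERIC POINTS OF A REAL SLICE ARE FIXED ONLY BY `±I` (Baire).**  For `x ∈ Sp_{2g}(ℝ)` and a COUNTABLE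
`S ⊂ Sp_{2g}(ℝ)`, the `Y` in the cone `C_g` such that every `P ∈ S` with `P • x • iY = x • iY` is `±I`
form a dense subset of `C_g` (a countable intersection of open dense sets in the locally compact cone).
[cite: GoreskyTai2003RealModuli, §4.4 («Such points exist, and even form a dense subset of `𝔥_n^γ` because … `𝔥_n^γ` is a translate … of the cone `iC_n`»)] -/
theorem dense_setOf_forall_smul_eq_imp (x : Matrix.symplecticGroup (Fin g) ℝ)
    {S : Set (Matrix.symplecticGroup (Fin g) ℝ)} (hS : S.Countable) :
    Dense {Y : PosDefCone (Fin g) | ∀ P ∈ S,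
      P • x • (⟨Complex.I • (Y : Matrix (Fin g) (Fin g) ℝ).map ((↑) : ℝ → ℂ),
          I_smul_map_ofReal_mem Y.posDef⟩ : siegelUpperHalfSpace g) =
        x • ⟨Complex.I • (Y : Matrix (Fin g) (Fin g) ℝ).map ((↑) : ℝ → ℂ),
          I_smul_map_ofReal_mem Y.posDef⟩ →
      (P : Matrix (Fin g ⊕ Fin g) (Fin g ⊕ Fin g) ℝ) = 1 ∨ (P : Matrix (Fin g ⊕ Fin g) (Fin g ⊕ Fin g) ℝ) = -1} := by
  have hΦ := continuous_smul_I_smul (g := g) x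
  have heq : {Y : PosDefCone (Fin g) | ∀ P ∈ S,
      P • x • (⟨Complex.I • (Y : Matrix (Fin g) (Fin g) ℝ).map ((↑) : ℝ → ℂ),
          I_smul_map_ofReal_mem Y.posDef⟩ : siegelUpperHalfSpace g) =
        x • ⟨Complex.I • (Y : Matrix (Fin g) (Fin g) ℝ).map ((↑) : ℝ → ℂ),
          I_smul_map_ofReal_mem Y.posDef⟩ →
      (P : Matrix (Fin g ⊕ Fin g) (Fin g ⊕ Fin g) ℝ) = 1 ∨ (P : Matrix (Fin g ⊕ Fin g) (Fin g ⊕ Fin g) ℝ) = -1} =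
      ⋂ P ∈ S, {Y : PosDefCone (Fin g) |
        P • x • (⟨Complex.I • (Y : Matrix (Fin g) (Fin g) ℝ).map ((↑) : ℝ → ℂ),
            I_smul_map_ofReal_mem Y.posDef⟩ : siegelUpperHalfSpace g) =
          x • ⟨Complex.I • (Y : Matrix (Fin g) (Fin g) ℝ).map ((↑) : ℝ → ℂ),
            I_smul_map_ofReal_mem Y.posDef⟩ →
        (P : Matrix (Fin g ⊕ Fin g) (Fin g ⊕ Fin g) ℝ) = 1 ∨ (P : Matrix (Fin g ⊕ Fin g) (Fin g ⊕ Fin g) ℝ) = -1} := by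
    ext Y
    simp only [Set.mem_setOf_eq, Set.mem_iInter]
  rw [heq]
  refine dense_biInter_of_isOpen (fun P _ ↦ ?_) hS (fun P _ ↦ ?_)
  · -- open: complement of a closed fixed-point condition, union a constant
    have hcl : IsClosed {Y : PosDefCone (Fin g) |
        P • x • (⟨Complex.I • (Y : Matrix (Fin g) (Fin g) ℝ).map ((↑) : ℝ → ℂ),
            I_smul_map_ofReal_mem Y.posDef⟩ : siegelUpperHalfSpace g) =
          x • ⟨Complex.I • (Y : Matrix (Fin g) (Fin g) ℝ).map ((↑) : ℝ → ℂ),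
            I_smul_map_ofReal_mem Y.posDef⟩} :=
      isClosed_eq (hΦ.const_smul P) hΦ
    have : {Y : PosDefCone (Fin g) |
        P • x • (⟨Complex.I • (Y : Matrix (Fin g) (Fin g) ℝ).map ((↑) : ℝ → ℂ),
            I_smul_map_ofReal_mem Y.posDef⟩ : siegelUpperHalfSpace g) =
          x • ⟨Complex.I • (Y : Matrix (Fin g) (Fin g) ℝ).map ((↑) : ℝ → ℂ),
            I_smul_map_ofReal_mem Y.posDef⟩ →
        (P : Matrix (Fin g ⊕ Fin g) (Fin g ⊕ Fin g) ℝ) = 1 ∨ (P : Matrix (Fin g ⊕ Fin g) (Fin g ⊕ Fin g) ℝ) = -1} =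
      {Y : PosDefCone (Fin g) |
        P • x • (⟨Complex.I • (Y : Matrix (Fin g) (Fin g) ℝ).map ((↑) : ℝ → ℂ),
            I_smul_map_ofReal_mem Y.posDef⟩ : siegelUpperHalfSpace g) =
          x • ⟨Complex.I • (Y : Matrix (Fin g) (Fin g) ℝ).map ((↑) : ℝ → ℂ),
            I_smul_map_ofReal_mem Y.posDef⟩}ᶜ ∪
      {_Y : PosDefCone (Fin g) |
        (P : Matrix (Fin g ⊕ Fin g) (Fin g ⊕ Fin g) ℝ) = 1 ∨ (P : Matrix (Fin g ⊕ Fin g) (Fin g ⊕ Fin g) ℝ) = -1} := by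
      ext Y
      simp only [Set.mem_setOf_eq, Set.mem_union, Set.mem_compl_iff]
      tauto
    rw [this]
    exact hcl.isOpen_compl.union isOpen_const
  · -- dense: either `P = ±I` (everything) or the fixed set has empty interior
    by_cases hP : (P : Matrix (Fin g ⊕ Fin g) (Fin g ⊕ Fin g) ℝ) = 1 ∨ (P : Matrix (Fin g ⊕ Fin g) (Fin g ⊕ Fin g) ℝ) = -1
    · have : {Y : PosDefCone (Fin g) |
          P • x • (⟨Complex.I • (Y : Matrix (Fin g) (Fin g) ℝ).map ((↑) : ℝ → ℂ),
              I_smul_map_ofReal_mem Y.posDef⟩ : siegelUpperHalfSpace g) =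
            x • ⟨Complex.I • (Y : Matrix (Fin g) (Fin g) ℝ).map ((↑) : ℝ → ℂ),
              I_smul_map_ofReal_mem Y.posDef⟩ →
          (P : Matrix (Fin g ⊕ Fin g) (Fin g ⊕ Fin g) ℝ) = 1 ∨ (P : Matrix (Fin g ⊕ Fin g) (Fin g ⊕ Fin g) ℝ) = -1} =
          Set.univ := Set.eq_univ_of_forall fun _ _ ↦ hP
      rw [this]; exact dense_univ
    · set F : Set (PosDefCone (Fin g)) := {Y : PosDefCone (Fin g) |
          P • x • (⟨Complex.I • (Y : Matrix (Fin g) (Fin g) ℝ).map ((↑) : ℝ → ℂ),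
              I_smul_map_ofReal_mem Y.posDef⟩ : siegelUpperHalfSpace g) =
            x • ⟨Complex.I • (Y : Matrix (Fin g) (Fin g) ℝ).map ((↑) : ℝ → ℂ),
              I_smul_map_ofReal_mem Y.posDef⟩} with hFdef
      have hsub : Fᶜ ⊆ {Y : PosDefCone (Fin g) |
          P • x • (⟨Complex.I • (Y : Matrix (Fin g) (Fin g) ℝ).map ((↑) : ℝ → ℂ),
              I_smul_map_ofReal_mem Y.posDef⟩ : siegelUpperHalfSpace g) =
            x • ⟨Complex.I • (Y : Matrix (Fin g) (Fin g) ℝ).map ((↑) : ℝ → ℂ),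
              I_smul_map_ofReal_mem Y.posDef⟩ →
          (P : Matrix (Fin g ⊕ Fin g) (Fin g ⊕ Fin g) ℝ) = 1 ∨ (P : Matrix (Fin g ⊕ Fin g) (Fin g ⊕ Fin g) ℝ) = -1} :=
        fun Y hY hfix ↦ absurd hfix hY
      refine Dense.mono hsub ?_
      rw [← interior_eq_empty_iff_dense_compl, Set.eq_empty_iff_forall_notMem]
      intro Y₀ hY₀
      exact hP (coe_eq_one_or_eq_neg_one_of_mem_interior x P hY₀)

/-- **«Such points exist»**: for every `x ∈ Sp_{2g}(ℝ)` the real slice `x · iC_g = {Ω : Re(x⁻¹ • Ω) = 0}`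
contains a point fixed by no element of `Γ_g = Sp_{2g}(ℤ)` other than `±I`.
[cite: GoreskyTai2003RealModuli, §4.4 proof of Cor. 11] -/
theorem exists_real_point_forall_smul_eq_imp (x : Matrix.symplecticGroup (Fin g) ℝ) :
    ∃ Ω : siegelUpperHalfSpace g,
      ((x⁻¹ • Ω : siegelUpperHalfSpace g) : Matrix (Fin g) (Fin g) ℂ).map Complex.re = 0 ∧
        ∀ P ∈ siegelModularGroup g, P • Ω = Ω →
          (P : Matrix (Fin g ⊕ Fin g) (Fin g ⊕ Fin g) ℝ) = 1 ∨ (P : Matrix (Fin g ⊕ Fin g) (Fin g ⊕ Fin g) ℝ) = -1 := by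
  haveI : Nonempty (PosDefCone (Fin g)) := ⟨⟨1, Matrix.PosDef.one⟩⟩
  obtain ⟨Y, hY⟩ := (dense_setOf_forall_smul_eq_imp x (countable_siegelModularGroup (g := g))).nonempty
  rw [Set.mem_setOf_eq] at hY
  refine ⟨x • ⟨Complex.I • (Y : Matrix (Fin g) (Fin g) ℝ).map ((↑) : ℝ → ℂ),
      I_smul_map_ofReal_mem Y.posDef⟩, ?_, ?_⟩
  · rw [inv_smul_smul]
    exact map_re_I_smul_map_ofReal _
  · -- `P ∈ Γ_g` as membership in the coerced set (explicitly, to keep the unifier off `MonoidHom.range`)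
    intro P hP hfix
    exact hY P (SetLike.mem_coe.2 hP) hfix

/-! ## §3 Integral coboundaries: `τ`-cocycles of `Γ_g(2)` are `τ(h)h⁻¹` with `h ∈ Sp_{2g}(ℤ)` -/

section Integral

variable (hg : 0 < g) {γ : Matrix.symplecticGroup (Fin g) ℤ}

include hg in
/-- **EVERY `τ`-COCYCLE OF `Γ_g(2)` IS AN INTEGRAL COBOUNDARY.**  If `γ ∈ Γ_g(2)` and `τ(γ)γ = 1`, then
`γ = τ(h)h⁻¹` for some `h ∈ Γ_g = Sp_{2g}(ℤ)`, and `𝔥_g^γ = h · iC_g`: by Prop. 1 (g52-#1) `𝔥_g^γ = x · iC_g`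
for some real `x`; by §2 it contains a point `Z` fixed by no element of `Sp_{2g}(ℤ)` other than `±I`; by
Prop. 10 (g51-#5) at that point `γ = τ(h)h⁻¹` with `h` integral.
[cite: GoreskyTai2003RealModuli, §4 Prop. 10, Cor. 11 and §4.4] -/
theorem exists_mem_siegelModularGroup_eq_iStarConj_mul_inv_of_mem_siegelPrincipalGamma_two
    (hγ : γ ∈ siegelPrincipalGamma g 2)
    (hcoc : (⟨Matrix.fromBlocks (-1 : Matrix (Fin g) (Fin g) ℝ) 0 0 (1 : Matrix (Fin g) (Fin g) ℝ) *
          ((symplecticIntHom g γ : Matrix.symplecticGroup (Fin g) ℝ) : Matrix (Fin g ⊕ Fin g) (Fin g ⊕ Fin g) ℝ) *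
          Matrix.fromBlocks (-1 : Matrix (Fin g) (Fin g) ℝ) 0 0 (1 : Matrix (Fin g) (Fin g) ℝ),
        iStar_mul_mul_iStar_mem_symplecticGroup (symplecticIntHom g γ).2⟩ : Matrix.symplecticGroup (Fin g) ℝ) *
        symplecticIntHom g γ = 1) :
    ∃ h ∈ siegelModularGroup g,
      symplecticIntHom g γ =
          (⟨Matrix.fromBlocks (-1 : Matrix (Fin g) (Fin g) ℝ) 0 0 (1 : Matrix (Fin g) (Fin g) ℝ) *
                (h : Matrix (Fin g ⊕ Fin g) (Fin g ⊕ Fin g) ℝ) *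
                Matrix.fromBlocks (-1 : Matrix (Fin g) (Fin g) ℝ) 0 0 (1 : Matrix (Fin g) (Fin g) ℝ),
              iStar_mul_mul_iStar_mem_symplecticGroup h.2⟩ : Matrix.symplecticGroup (Fin g) ℝ) * h⁻¹ ∧
        ∀ Ω : siegelUpperHalfSpace g,
          symplecticIntHom g γ • Ω = ⟨-(Ω : Matrix (Fin g) (Fin g) ℂ).map conj, neg_map_conj_mem_siegelUpperHalfSpace Ω.2⟩ ↔
            ((h⁻¹ • Ω : siegelUpperHalfSpace g) : Matrix (Fin g) (Fin g) ℂ).map Complex.re = 0 := by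
  obtain ⟨x, hx⟩ := exists_eq_iStarConj_mul_inv_of_iStar_mul_self_eq_one (symplecticIntHom g γ) hcoc
  obtain ⟨Ω, hre, hstab⟩ := exists_real_point_forall_smul_eq_imp (g := g) x
  have hsmul : symplecticIntHom g γ • Ω =
      ⟨-(Ω : Matrix (Fin g) (Fin g) ℂ).map conj, neg_map_conj_mem_siegelUpperHalfSpace Ω.2⟩ := by
    rw [hx]; exact (smul_eq_negConj_iff_of_coboundary x Ω).2 hre
  exact exists_coboundary_of_mem_siegelPrincipalGamma_two (fun _ ↦ Nat.one_pos) Ω.2 hg hstab hγ hsmul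

include hg in
/-- **COROLLARY 11 without its `Γ_{2m}(2)`-refinement**: for `γ ∈ Γ_g(q)` with `q ≥ 3` even (e.g. `Γ(4m)`,
`m ≥ 1`) and `𝔥_g^γ ≠ ∅`, `γ = τ(h)h⁻¹` for some INTEGRAL `h ∈ Sp_{2g}(ℤ)`, and `𝔥_g^γ = h · iC_g` («Suppose
`γ ∈ Γ(4m)` and `𝔥_n^γ ≠ ∅`.  Then there exists `g ∈ Γ_{2m}(2)` such that `γ = g̃g⁻¹`»; the cocycle condition is
automatic at level `≥ 3`, g51-#6; the last step `h = βu`, `β ∈ Γ_{2m}(2)` of §4.4 (Lemma 9 (3)) is not taken here).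
[cite: GoreskyTai2003RealModuli, §4 Cor. 11 and §4.4] -/
theorem exists_mem_siegelModularGroup_eq_iStarConj_mul_inv_of_exists_smul_eq_negConj {q : ℕ} (hq : 3 ≤ q)
    (hq2 : 2 ∣ q) (hγ : γ ∈ siegelPrincipalGamma g q)
    (hreal : ∃ Ω : siegelUpperHalfSpace g, symplecticIntHom g γ • Ω =
      ⟨-(Ω : Matrix (Fin g) (Fin g) ℂ).map conj, neg_map_conj_mem_siegelUpperHalfSpace Ω.2⟩) :
    ∃ h ∈ siegelModularGroup g,
      symplecticIntHom g γ =
          (⟨Matrix.fromBlocks (-1 : Matrix (Fin g) (Fin g) ℝ) 0 0 (1 : Matrix (Fin g) (Fin g) ℝ) *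
                (h : Matrix (Fin g ⊕ Fin g) (Fin g ⊕ Fin g) ℝ) *
                Matrix.fromBlocks (-1 : Matrix (Fin g) (Fin g) ℝ) 0 0 (1 : Matrix (Fin g) (Fin g) ℝ),
              iStar_mul_mul_iStar_mem_symplecticGroup h.2⟩ : Matrix.symplecticGroup (Fin g) ℝ) * h⁻¹ ∧
        ∀ Ω : siegelUpperHalfSpace g,
          symplecticIntHom g γ • Ω = ⟨-(Ω : Matrix (Fin g) (Fin g) ℂ).map conj, neg_map_conj_mem_siegelUpperHalfSpace Ω.2⟩ ↔
            ((h⁻¹ • Ω : siegelUpperHalfSpace g) : Matrix (Fin g) (Fin g) ℂ).map Complex.re = 0 := by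
  obtain ⟨Ω, hΩ⟩ := hreal
  exact exists_mem_siegelModularGroup_eq_iStarConj_mul_inv_of_mem_siegelPrincipalGamma_two hg
    (siegelPrincipalGamma_anti hq2 hγ) (iStar_mul_self_eq_one_of_mem_siegelPrincipalGamma hq hγ hΩ)

end Integral

end SiegelModuli

end Literature.AlgebraicGeometry.ModuliOfAbelianVarieties
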